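import Summits.QuantumFields.YangMills.Theorems.PoincareLipschitzKnitDoorRows
import HarnessLib

/-!
# Crux stmt-QuantumFields-19936 `UnitScaleTilt.HistoryTailL`, route crux `PoincareLipschitz.BlockLipschitzL` (stmt-QuantumFields-23533), K2 FINAL KNIT —
# the DOOR ROWS ON THE LOG-FREE ROAD `T r = ε₁·r` (★w5 g12's F4′ `oneStep_logFree`: ✓`hOneStep_holds`' text with the factor `(1 + log r)^6` DELETED)

Cell `ym3-torus` (YM ladder rung R3 = continuum SU(2) Yang–Mills on the three-torus — a RUNG, NOT the Clay problem: not d = 4, not infinite volume, not a mass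
gap); width seat `ym-ust-19936-w2` gen 12.  THEOREMS ONLY (def-free, default heartbeats); `--supports stmt-QuantumFields-19936 --as helper`.  A corollary of
✓`PoincareLipschitzKnitDoorRows` §3 at the constant weight `g ≡ 1` (✓`threshold_of_antitone`'s shape `T r = ε₁·r·g r`): the same two rows of
✓`PoincareLipschitzSmallRangeOfOneStepSrc.norm_sub_le_of_oneStep_src` at `d = 3`, now under the WINDOW-FREE regime row `τ₀·m^K ≤ √ε₁∕(288m)` — with a
log-free [C] the knit needs `hImproveCore` at ONE comparable scale only (LEAD w1 g9 RULING g9-6).  Nothing here proves the door, F4′, `hImproveCore`, `hRegH`,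
a stub, `BlockLipschitzL`, `HistoryTailL` or a summit statement — real arithmetic only.
* ★★★ `doorRows_logFree` — `∀ m ≥ 2, ∀ ε₁ > 0, ∃ c > 0 (= √ε₁∕(288m)), ∀ τ₀ K T s, 0 ≤ τ₀ → (T r = ε₁·r, r ≥ 1) → (s r ≤ 2·(4τ₀√(3(2r+1)³·T r) + 2τ₀²·3(2r+1)³),
  r ≥ 1) → τ₀·m^K ≤ c → (row (i) ∀ k < K) ∧ (row (ii) ∀ 1 ≤ k ≤ K, N_s = 324·(τ₀√ε₁ + τ₀²m^K))`.
[folklore] ([Giaquinta1984] Ch. III Lemma 2.1 p.86; [SchoenUhlenbeck1982] §4.)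
-/

set_option autoImplicit false

noncomputable section

namespace Summit.QuantumFields.YangMills.Theorems.PoincareLipschitzKnitDoorRowsLogFree

open Summit.QuantumFields.YangMills.Theorems.PoincareLipschitzKnitDoorRows

/-- ★★★ **THE DOOR ROWS, LOG-FREE, PACKAGED**: for `m ≥ 2` and `ε₁ > 0`, with `c := √ε₁∕(288m)`: for all `τ₀ ≥ 0`, `K`, `T r = ε₁·r` and
`s r ≤ 2·(4τ₀√(3(2r+1)³·T r) + 2τ₀²·3(2r+1)³)` (`r ≥ 1`), the regime row `τ₀·m^K ≤ c` gives (i) `(2m²)⁻¹·T(m^{k+1}) + s(m^{k+1}) ≤ T(m^k)` for `k < K`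
and (ii) `s(m^k) ≤ 324·(τ₀√ε₁ + τ₀²m^K)·(m²)^k` for `1 ≤ k ≤ K` (✓`norm_sub_le_of_oneStep_src`'s `hT`∕`hS` at `d = 3`; `g ≡ 1` in ✓`doorRow_threshold`).
[folklore] [cite: Giaquinta1984, Ch. III Lemma 2.1 p.86; SchoenUhlenbeck1982, §4] -/
theorem doorRows_logFree {m : ℕ} (hm : 2 ≤ m) {ε₁ : ℝ} (hε₁ : 0 < ε₁) :
    ∃ c : ℝ, 0 < c ∧ ∀ (τ₀ : ℝ) (K : ℕ) (T s : ℤ → ℝ), 0 ≤ τ₀ →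
      (∀ r : ℤ, 1 ≤ r → T r = ε₁ * r) →
      (∀ r : ℤ, 1 ≤ r → s r ≤ 2 * (4 * τ₀ * Real.sqrt (3 * (2 * (r : ℝ) + 1) ^ 3 * T r) + 2 * τ₀ ^ 2 * (3 * (2 * (r : ℝ) + 1) ^ 3))) →
      τ₀ * (m : ℝ) ^ K ≤ c →
      (∀ k : ℕ, k < K → (2 * (m : ℝ) ^ 2)⁻¹ * T ((m : ℤ) ^ (k + 1)) + s ((m : ℤ) ^ (k + 1)) ≤ T ((m : ℤ) ^ k)) ∧
      (∀ k : ℕ, 1 ≤ k → k ≤ K → s ((m : ℤ) ^ k) ≤ 324 * (τ₀ * Real.sqrt ε₁ + τ₀ ^ 2 * (m : ℝ) ^ K) * ((m : ℝ) ^ 2) ^ k) := by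
  have hm1 : (1 : ℝ) ≤ m := by exact_mod_cast (by omega : 1 ≤ m)
  have hm0 : (0 : ℝ) < m := by linarith
  have hsq : 0 < Real.sqrt ε₁ := Real.sqrt_pos.2 hε₁
  refine ⟨Real.sqrt ε₁ / (288 * m), by positivity, fun τ₀ K T s hτ0 hT hs hreg => ?_⟩
  -- the constant weight `g ≡ 1`
  have hT' : ∀ r : ℤ, 1 ≤ r → T r = ε₁ * r * (fun _ : ℝ => (1 : ℝ)) r := fun r hr => by rw [hT r hr]; simp
  have hT0 : ∀ r : ℤ, 1 ≤ r → 0 ≤ T r := fun r hr => by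
    have hr1 : (1 : ℝ) ≤ r := by exact_mod_cast hr
    rw [hT r hr]; exact mul_nonneg hε₁.le (by linarith)
  have hs' : ∀ r : ℤ, 1 ≤ r → s r ≤ 2 * (4 * τ₀ * Real.sqrt (81 * (r : ℝ) ^ 3 * T r) + 2 * τ₀ ^ 2 * (81 * (r : ℝ) ^ 3)) :=
    fun r hr => (hs r hr).trans (source_three_le_source_81 hτ0 (hT0 r hr) hr)
  refine ⟨?_, ?_⟩
  · refine doorRow_threshold hm hε₁.le hτ0 (fun _ => (1 : ℝ)) (fun _ _ => zero_le_one) (fun _ _ _ _ => le_rfl) T hT' s hs' K ?_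
    rw [mul_one]
    have h3 := mul_le_mul_of_nonneg_left hreg (by positivity : (0 : ℝ) ≤ 288 * m)
    have e1 : (288 * (m : ℝ)) * (τ₀ * (m : ℝ) ^ K) = 288 * τ₀ * (m : ℝ) ^ (K + 1) := by rw [pow_succ]; ring
    have e2 : (288 * (m : ℝ)) * (Real.sqrt ε₁ / (288 * m)) = Real.sqrt ε₁ := by field_simp
    rw [e1, e2] at h3
    exact h3
  · intro k hk hkK
    have h := doorRow_morrey (by omega : 1 ≤ m) hε₁.le hτ0 (fun _ => (1 : ℝ)) (fun _ _ => zero_le_one) (fun _ _ _ _ => le_rfl) le_rfl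
      T hT' s hs' K k hk hkK
    have hpos : (0 : ℝ) ≤ ((m : ℝ) ^ 2) ^ k := by positivity
    have hcoef : 72 * τ₀ * Real.sqrt ε₁ + 324 * τ₀ ^ 2 * (m : ℝ) ^ K ≤ 324 * (τ₀ * Real.sqrt ε₁ + τ₀ ^ 2 * (m : ℝ) ^ K) := by
      have : 0 ≤ τ₀ * Real.sqrt ε₁ := mul_nonneg hτ0 (Real.sqrt_nonneg _)
      linarith
    exact h.trans (mul_le_mul_of_nonneg_right hcoef hpos)

end Summit.QuantumFields.YangMills.Theorems.PoincareLipschitzKnitDoorRowsLogFree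

end
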